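import Summits.QuantumFields.YangMills.Theorems.AlphaInputsT3ACv3TubeGraft
import Summits.QuantumFields.YangMills.Theorems.AlphaInputsT3ACv3AvgIterLocality
import HarnessLib

/-!
# `AlphaInputsT3ACv3SectionCorner` — START v3.1 (S5)-4b, file 1: **WHERE THE ITERATED SECTION IS NOT FLAT** — a finest plaquette `q` has `(iterSec k W)(∂q) = 1` unless its source is the LAST
# site of its level-`k` cell in BOTH plaquette directions, and then `(iterSec k W)(∂q) = W(∂Q)` for the coarse plaquette `Q = ⟨coarsen k q.src; q.μ, q.ν⟩`; and EVERY fine site is a chart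
# point `boxSite (cornerSite k (coarsen k x) μ ν) (chartCoord k x μ ν)` of the tube chart of its own cell, with transverse coordinates in `[−(L^k−1), 0]` (`= 0` iff last) and
# longitudinal ones in `[−⌊L^k/2⌋, ⌊L^k/2⌋]` — cell `ym3-torus`, width seat `ym-ust-19936-w2` (g2), for the (A5 = hcov) binder of ★w1 g2 LEAD's `…StartAssembly.dist1_plaqHol_startU_le`

WHY ((S5)-4b, LEAD 03:24:30Z: «(A5) via `RegionSection.plaqHol_iterSec_eq_one_or`: non-flat ⇒ transverse plaquette at chart (0,0) of a corner line»).  `RegionSection.plaqHol_iterSec_eq_one_or`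
identifies the VALUE of a non-flat section plaquette but not its POSITION; the coverage binder needs the position (the plaquette must touch an active tube bond, read in the tube's
chart).  This file gives both from the closed form `SectionChart.iterSec_apply`.
WHAT.  §1 `coarsen_shift_of_last` ∕ `coarsen_shift_of_not_last` (the `k`-fold block of `x + e_μ` is the block of `x` shifted iff `x` is last in its cell along `μ`; iterated
`B10StarCount.blockOf_shift` with the digit identity `SectionChart.mod_mul_eq_pred_iff`), `coarsen_congr_of_apply_eq`; §2 ★ `plaqHol_iterSec_of_not_last` (`= 1`), ★★ `plaqHol_iterSec_of_last`
(`= W(∂⟨coarsen k q.src; q.μ, q.ν⟩)`); §3 def `chartCoord k x μ ν`, ★ `boxSite_cornerSite_chartCoord` (`= x`), `chartCoord_transverse_bounds`, `chartCoord_transverse_eq_zero_iff` (last ⇔ `0`),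
`abs_chartCoord_longitudinal_le`, `inTube_chartCoord_of_last`.
HONEST FRAMING.  Lattice bookkeeping over the LEAD's chart; no analysis; count-neutral helper toward the (FL) row of 2′∕2′χ (`--supports stmt-QuantumFields-19936`); (S5), (FL)∕`hLift`, the stub,
the crux and the gap are NOT claimed; registry untouched.  YM₃ on the three-torus is RUNG R3 of the programme, not the Clay problem.

References: T. Bałaban, Commun. Math. Phys. 102 (1985) 277–309 [Balaban1985Variational] ((11) p.279); Commun. Math. Phys. 109 (1987) 249–301 [Balaban1987RG1] ((0.1), (0.3) pp.251–252).
-/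

set_option autoImplicit false

noncomputable section

namespace Summit.QuantumFields.YangMills.Theorems.TubeStart

open Literature.MathematicalPhysics.QuantumFieldTheory.Balaban1983to89
open Literature.MathematicalPhysics.QuantumFieldTheory.Balaban1983to89.BlockAveragingSectionAction (iterSec)
open Summit.QuantumFields.Balaban3D.Carriers
open Summit.QuantumFields.Balaban3D.Proofs.TorusLift (val_coarsen)
open Summit.QuantumFields.YangMills.Theorems.ModelBox

variable {P : Params}

/-! ## §1 The `k`-fold block of a shifted site -/

/-- `x` is the last site of its level-`k` cell in direction `μ`: `x_μ mod L^k = L^k − 1`. [cite: Balaban1987RG1, (0.3) p.252] -/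
def IsLast (k : ℕ) (x : Site P 0) (μ : Fin P.d) : Prop := (x μ).val % P.L ^ k = P.L ^ k - 1

/-- The digit identity one level up: last at level `k+1` iff last at level `k` and the `k`-th digit is `L − 1`. [cite: Balaban1987RG1, (0.3) p.252] -/
theorem isLast_succ_iff {k : ℕ} (hk : k ≤ P.m + P.K) (x : Site P 0) (μ : Fin P.d) :
    IsLast (k + 1) x μ ↔ IsLast k x μ ∧ ((coarsen k x) μ).val % P.L + 1 = P.L := by
  have hL : 0 < P.L := P.L_pos
  have hLk : 0 < P.L ^ k := pow_pos hL k
  unfold IsLast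
  rw [pow_succ, SectionChart_digit hLk hL, val_coarsen k hk x μ]
  constructor
  · rintro ⟨h1, h2⟩; exact ⟨h1, by omega⟩
  · rintro ⟨h1, h2⟩; exact ⟨h1, by omega⟩
where
  /-- local alias of `mod_mul_eq_pred_iff`. [folklore] -/
  SectionChart_digit {n m L : ℕ} (hm : 0 < m) (hL : 0 < L) : n % (m * L) = m * L - 1 ↔ n % m = m - 1 ∧ (n / m) % L = L - 1 := mod_mul_eq_pred_iff hm hL

/-- Every site is «last at level 0». [folklore] -/
theorem isLast_zero (x : Site P 0) (μ : Fin P.d) : IsLast 0 x μ := by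
  unfold IsLast; simp [Nat.mod_one]

/-- **IF `x` IS LAST ALONG `μ`, THE BLOCK OF `x + e_μ` IS THE NEXT BLOCK**: `coarsen k (x + e_μ) = (coarsen k x) + e_μ`. [cite: Balaban1987RG1, (0.3) p.252] -/
theorem coarsen_shift_of_last : ∀ (k : ℕ), k ≤ P.m + P.K → ∀ (x : Site P 0) (μ : Fin P.d), IsLast k x μ → coarsen k (x.shift μ) = (coarsen k x).shift μ
  | 0, _, _, _, _ => rfl
  | k + 1, hk, x, μ, h => by
    have hk' : k ≤ P.m + P.K := (Nat.le_succ k).trans hk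
    obtain ⟨h1, h2⟩ := (isLast_succ_iff hk' x μ).mp h
    rw [coarsen_succ, coarsen_succ, coarsen_shift_of_last k hk' x μ h1, B10StarCount.blockOf_shift hk, if_pos h2]

/-- **IF `x` IS NOT LAST ALONG `μ`, `x + e_μ` IS IN THE SAME BLOCK**: `coarsen k (x + e_μ) = coarsen k x`. [cite: Balaban1987RG1, (0.3) p.252] -/
theorem coarsen_shift_of_not_last : ∀ (k : ℕ), k ≤ P.m + P.K → ∀ (x : Site P 0) (μ : Fin P.d), ¬ IsLast k x μ → coarsen k (x.shift μ) = coarsen k x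
  | 0, _, x, μ, h => absurd (isLast_zero x μ) h
  | k + 1, hk, x, μ, h => by
    have hk' : k ≤ P.m + P.K := (Nat.le_succ k).trans hk
    rw [isLast_succ_iff hk' x μ, not_and_or] at h
    rw [coarsen_succ, coarsen_succ]
    by_cases h1 : IsLast k x μ
    · have h2 : ¬ (((coarsen k x) μ).val % P.L + 1 = P.L) := h.resolve_left (not_not.mpr h1)
      rw [coarsen_shift_of_last k hk' x μ h1, B10StarCount.blockOf_shift hk, if_neg h2]
    · rw [coarsen_shift_of_not_last k hk' x μ h1]

/-- A shift in another direction does not change last-ness. [folklore] -/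
theorem isLast_shift_of_ne (k : ℕ) (x : Site P 0) {μ κ : Fin P.d} (h : μ ≠ κ) : IsLast k (x.shift κ) μ ↔ IsLast k x μ := by
  unfold IsLast
  rw [show (x.shift κ) μ = x μ from by simp [Site.shift, Function.update_of_ne h]]

/-! ## §2 The plaquettes of the iterated section -/

section Section

variable {G : Type*} [GaugeGroup G] {k : ℕ} (hk : k ≤ P.m + P.K) (W : GaugeField P k G) (q : Plaq P 0)
include hk

/-- **★ OFF THE CORNER LINES THE SECTION IS FLAT**: if `q.src` is not last along `q.μ` or not last along `q.ν`, `(iterSec k W)(∂q) = 1`. [cite: Balaban1985Variational, (11) p.279] -/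
theorem plaqHol_iterSec_of_not_last (h : ¬ IsLast k q.src q.μ ∨ ¬ IsLast k q.src q.ν) : GaugeField.plaqHol (iterSec k W) q = 1 := by
  have hne : q.μ ≠ q.ν := ne_of_lt q.hμν
  simp only [GaugeField.plaqHol]
  rcases h with hμ | hν
  · -- the two `μ`-bonds are trivial; the two `ν`-bonds read the same coarse bond
    have e1 : iterSec k W ⟨q.src, q.μ⟩ = 1 := iterSec_apply_of_not_last hk W q.src q.μ hμ
    have e3 : iterSec k W ⟨q.src.shift q.ν, q.μ⟩ = 1 := iterSec_apply_of_not_last hk W _ q.μ (fun h => hμ ((isLast_shift_of_ne k q.src hne).mp h))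
    rw [e1, e3, one_mul, inv_one, mul_one]
    by_cases hν : IsLast k q.src q.ν
    · have hν' : IsLast k (q.src.shift q.μ) q.ν := (isLast_shift_of_ne k q.src hne.symm).mpr hν
      rw [iterSec_apply_of_last hk W _ q.ν hν', iterSec_apply_of_last hk W _ q.ν hν, coarsen_shift_of_not_last k hk q.src q.μ hμ, mul_inv_cancel]
    · have hν' : ¬ IsLast k (q.src.shift q.μ) q.ν := fun h => hν ((isLast_shift_of_ne k q.src hne.symm).mp h)
      rw [iterSec_apply_of_not_last hk W _ q.ν hν', iterSec_apply_of_not_last hk W _ q.ν hν, inv_one, mul_one]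
  · have e2 : iterSec k W ⟨q.src.shift q.μ, q.ν⟩ = 1 := iterSec_apply_of_not_last hk W _ q.ν (fun h => hν ((isLast_shift_of_ne k q.src hne.symm).mp h))
    have e4 : iterSec k W ⟨q.src, q.ν⟩ = 1 := iterSec_apply_of_not_last hk W q.src q.ν hν
    rw [e2, e4, mul_one, inv_one, mul_one]
    by_cases hμ : IsLast k q.src q.μ
    · have hμ' : IsLast k (q.src.shift q.ν) q.μ := (isLast_shift_of_ne k q.src hne).mpr hμ
      rw [iterSec_apply_of_last hk W _ q.μ hμ', iterSec_apply_of_last hk W _ q.μ hμ, coarsen_shift_of_not_last k hk q.src q.ν hν, mul_inv_cancel]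
    · have hμ' : ¬ IsLast k (q.src.shift q.ν) q.μ := fun h => hμ ((isLast_shift_of_ne k q.src hne).mp h)
      rw [iterSec_apply_of_not_last hk W _ q.μ hμ', iterSec_apply_of_not_last hk W _ q.μ hμ, inv_one, mul_one]

/-- **★★ ON A CORNER LINE THE SECTION PLAQUETTE IS THE COARSE PLAQUETTE**: if `q.src` is last along both `q.μ` and `q.ν`, `(iterSec k W)(∂q) = W(∂⟨coarsen k q.src; q.μ, q.ν⟩)`.
[cite: Balaban1985Variational, (11) p.279] -/
theorem plaqHol_iterSec_of_last (hμ : IsLast k q.src q.μ) (hν : IsLast k q.src q.ν) :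
    GaugeField.plaqHol (iterSec k W) q = GaugeField.plaqHol W ⟨coarsen k q.src, q.μ, q.ν, q.hμν⟩ := by
  have hne : q.μ ≠ q.ν := ne_of_lt q.hμν
  have hν' : IsLast k (q.src.shift q.μ) q.ν := (isLast_shift_of_ne k q.src hne.symm).mpr hν
  have hμ' : IsLast k (q.src.shift q.ν) q.μ := (isLast_shift_of_ne k q.src hne).mpr hμ
  simp only [GaugeField.plaqHol]
  rw [iterSec_apply_of_last hk W _ q.μ hμ, iterSec_apply_of_last hk W _ q.ν hν', iterSec_apply_of_last hk W _ q.μ hμ', iterSec_apply_of_last hk W _ q.ν hν,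
    coarsen_shift_of_last k hk q.src q.μ hμ, coarsen_shift_of_last k hk q.src q.ν hν]

/-- The dichotomy packaged. [cite: Balaban1985Variational, (11) p.279] -/
theorem plaqHol_iterSec_ne_one_imp (h : GaugeField.plaqHol (iterSec k W) q ≠ 1) :
    IsLast k q.src q.μ ∧ IsLast k q.src q.ν ∧ GaugeField.plaqHol (iterSec k W) q = GaugeField.plaqHol W ⟨coarsen k q.src, q.μ, q.ν, q.hμν⟩ := by
  by_cases hμ : IsLast k q.src q.μ
  · by_cases hν : IsLast k q.src q.ν
    · exact ⟨hμ, hν, plaqHol_iterSec_of_last hk W q hμ hν⟩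
    · exact absurd (plaqHol_iterSec_of_not_last hk W q (Or.inr hν)) h
  · exact absurd (plaqHol_iterSec_of_not_last hk W q (Or.inl hμ)) h

end Section

/-! ## §3 Every fine site is a chart point of its own cell -/

section Chart

variable (k : ℕ) (x : Site P 0) (μ ν : Fin P.d)

/-- **THE CHART COORDINATES OF A FINE SITE IN ITS OWN CELL** (corner chart of `…SectionChart`): the in-cell position minus the corner position (`L^k − 1` transversally, `⌊L^k/2⌋`
longitudinally). [cite: Balaban1987RG1, (0.1) p.251] -/
def chartCoord : Fin P.d → ℤ := fun i =>
  (((x i).val % P.L ^ k : ℕ) : ℤ) - ((if i = μ ∨ i = ν then 2 * (P.L ^ k / 2) else P.L ^ k / 2 : ℕ) : ℤ)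

/-- **★ THE CHART HITS THE SITE**: `boxSite (cornerSite k (coarsen k x) μ ν) (chartCoord k x μ ν) = x` (standing range `k ≤ m + K`). [cite: Balaban1987RG1, (0.1) p.251] -/
theorem boxSite_cornerSite_chartCoord (hk : k ≤ P.m + P.K) : boxSite (cornerSite k (coarsen k x) μ ν) (chartCoord k x μ ν) = x := by
  funext i
  have hdm : (x i).val / P.L ^ k * P.L ^ k + (x i).val % P.L ^ k = (x i).val := Nat.div_add_mod' _ _
  simp only [boxSite, cornerSite, chartCoord]
  rw [val_coarsen k hk x i]
  set off : ℕ := (if i = μ ∨ i = ν then 2 * (P.L ^ k / 2) else P.L ^ k / 2) with hoff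
  set a : ℕ := (x i).val / P.L ^ k with ha
  set r : ℕ := (x i).val % P.L ^ k with hr
  set M : ℕ := P.L ^ k with hM
  have e : (((a * M + off : ℕ) : ZMod (P.sitesPerDir 0)) + ((((r : ℕ) : ℤ) - ((off : ℕ) : ℤ) : ℤ) : ZMod (P.sitesPerDir 0))) = ((a * M + r : ℕ) : ZMod (P.sitesPerDir 0)) := by
    push_cast; ring
  rw [e, hdm, ZMod.natCast_zmod_val]

/-- Transverse coordinates lie in `[−2⌊L^k/2⌋, 0]`. [folklore] -/
theorem chartCoord_transverse_bounds {i : Fin P.d} (hi : i = μ ∨ i = ν) : -(2 * (P.L ^ k / 2 : ℕ) : ℤ) ≤ chartCoord k x μ ν i ∧ chartCoord k x μ ν i ≤ 0 := by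
  have hm : (x i).val % P.L ^ k < P.L ^ k := Nat.mod_lt _ (pow_pos P.L_pos k)
  have hodd := pow_eq_two_mul_half_add_one (P := P) k
  have h : chartCoord k x μ ν i = (((x i).val % P.L ^ k : ℕ) : ℤ) - ((2 * (P.L ^ k / 2) : ℕ) : ℤ) := by simp only [chartCoord, if_pos hi]
  rw [h]
  generalize P.L ^ k = M at hm hodd ⊢
  constructor <;> omega

/-- A transverse coordinate vanishes iff the site is last along that direction. [folklore] -/
theorem chartCoord_transverse_eq_zero_iff {i : Fin P.d} (hi : i = μ ∨ i = ν) : chartCoord k x μ ν i = 0 ↔ IsLast k x i := by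
  have hodd := pow_eq_two_mul_half_add_one (P := P) k
  have hm : (x i).val % P.L ^ k < P.L ^ k := Nat.mod_lt _ (pow_pos P.L_pos k)
  have h : chartCoord k x μ ν i = (((x i).val % P.L ^ k : ℕ) : ℤ) - ((2 * (P.L ^ k / 2) : ℕ) : ℤ) := by simp only [chartCoord, if_pos hi]
  unfold IsLast
  rw [h]
  generalize P.L ^ k = M at hm hodd ⊢
  omega

/-- Longitudinal coordinates lie in `[−⌊L^k/2⌋, ⌊L^k/2⌋]`. [folklore] -/
theorem abs_chartCoord_longitudinal_le {i : Fin P.d} (hi : ¬ (i = μ ∨ i = ν)) : |chartCoord k x μ ν i| ≤ ((P.L ^ k / 2 : ℕ) : ℤ) := by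
  have hm : (x i).val % P.L ^ k < P.L ^ k := Nat.mod_lt _ (pow_pos P.L_pos k)
  have hodd := pow_eq_two_mul_half_add_one (P := P) k
  have h : chartCoord k x μ ν i = (((x i).val % P.L ^ k : ℕ) : ℤ) - ((P.L ^ k / 2 : ℕ) : ℤ) := by simp only [chartCoord, if_neg hi]
  rw [h, abs_le]
  generalize P.L ^ k = M at hm hodd ⊢
  constructor <;> omega

/-- **A SITE LAST IN BOTH TRANSVERSE DIRECTIONS HAS CHART COORDINATES `(0, 0, ·)` IN THE TUBE BOX** of any transverse radius `Rt`. [cite: Balaban1985Variational, (11) p.279] -/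
theorem inTube_chartCoord_of_last (Rt : ℕ) (hμ : IsLast k x μ) (hν : IsLast k x ν) : InTube μ ν Rt (P.L ^ k / 2) (chartCoord k x μ ν) := by
  intro i
  by_cases hi : i = μ ∨ i = ν
  · have h0 : chartCoord k x μ ν i = 0 := by
      rcases hi with rfl | rfl
      · exact (chartCoord_transverse_eq_zero_iff k x i ν (Or.inl rfl)).mpr hμ
      · exact (chartCoord_transverse_eq_zero_iff k x μ i (Or.inr rfl)).mpr hν
    rw [h0, if_pos hi, abs_zero]; positivity
  · rw [if_neg hi]; exact abs_chartCoord_longitudinal_le k x μ ν hi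

/-- The transverse chart coordinates of a doubly-last site vanish. [folklore] -/
theorem chartCoord_eq_zero_of_last {i : Fin P.d} (hi : i = μ ∨ i = ν) (hμ : IsLast k x μ) (hν : IsLast k x ν) : chartCoord k x μ ν i = 0 := by
  rcases hi with rfl | rfl
  · exact (chartCoord_transverse_eq_zero_iff k x i ν (Or.inl rfl)).mpr hμ
  · exact (chartCoord_transverse_eq_zero_iff k x μ i (Or.inr rfl)).mpr hν

end Chart

end Summit.QuantumFields.YangMills.Theorems.TubeStart

end
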